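import Summits.CriticalPhenomena.PercolationContinuityZ3.Theorems.PercNearOneGluingNoHeavyLowerTailSahiOneStepUniformThreshold
import Summits.CriticalPhenomena.PercolationContinuityZ3.Theorems.PercNearOneGluingNoHeavyLowerTailSahiOneStepUpperMonoB
import HarnessLib

/-!
# Two-sided lumping — UPPER MONO-A: the upper-ball drift of a dominant event is nonnegative

Support file (prover prim-ineq-prove-3 gen 50; `--supports stmt-CriticalPhenomena-4575`; memo
`run/shared/lean/prim/prim-ineq-prove-3/FINDING-G50-TWO-SIDED-LUMPING.md`, §2.3 lemma S3).  No definitions, no named facts, no sorries, no `native_decide`.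

Mirror image, for the UPPER Hamming ball `{r ≤ N_F}`, of gen 21's MONO-A (`drift_nonneg_of_dominant`).  Block `insert e F` (`e ∉ F`), densities in
`(0,1)` on `F` (ANY values — no uniformity), an increasing `insert e F`-determined event `A` which is **`e`-dominant**: `ω ∈ A`, `e ∉ ω`, `j ∈ F ∩ ω` ⟹
`(ω ∖ {j}) ∪ {e} ∈ A`.  With the sections `A¹ = {ω | insert e ω ∈ A} ⊇ A⁰ = {ω | ω ∖ {e} ∈ A}`:
`μ{r ≤ N_F}·μ(A⁰ ∩ {r+1 ≤ N_F}) ≤ μ{r+1 ≤ N_F}·μ(A¹ ∩ {r ≤ N_F})`, i.e. `μ(A⁰ | N_F ≥ r+1) ≤ μ(A¹ | N_F ≥ r)` (`upperDrift_nonneg_of_dominant`) —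
the sign `ΔA^U ≥ 0` of the upper correction term in the two-sided pivot identity (memo TL1).  Proof = memo S3: the shadow inequality
`real_shadow_layer_mul_le` (`∂⁻A⁰ ⊆ A¹`, so the density of `A¹` at level `k` is at least that of `A⁰` at level `k+1`), the layer monotonicity of `A¹`,
the log-concavity of the layer law `real_layer_logConcave`, and the MLR comparison `sum_mul_sum_le_of_mlr` with the weight shift REVERSED
(`u_k = π_k`, `v_k = π_{k+1}`, the top weight being the empty layer above `#F`).
-/

noncomputable section

namespace Summit.CriticalPhenomena.PercolationContinuityZ3.Theorems

namespace SahiOneStep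

open MeasureTheory Finset
open Literature.Probability.Percolation (DeterminedBy determinedBy_iff)
open Literature.Probability.LatticeModels (prodBernoulli)
open SahiE3Sections (determinedBy_section_insert determinedBy_section_sdiff)
open scoped Classical

variable {ι : Type*} [Fintype ι]

/-! ## Upper regions as layer sums -/

omit [Fintype ι] in
/-- A layer above the block size is empty. [folklore] -/
theorem layer_eq_empty_of_card_lt (F : Finset ι) {k : ℕ} (hk : F.card < k) :
    {ω : Set ι | (F.filter (· ∈ ω)).card = k} = ∅ := by
  ext ω
  simp only [Set.mem_setOf_eq, Set.mem_empty_iff_false, iff_false]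
  have := Finset.card_le_card (Finset.filter_subset (· ∈ ω) F)
  omega

/-- The measure of `X ∩ {r ≤ N_F}` is the sum of the measures of `X ∩ {N_F = r + i}`, `i < d`, whenever `r + d = #F + 1`. [folklore] -/
theorem real_inter_upper_eq_sum (p : ι → unitInterval) (F : Finset ι) (X : Set (Set ι)) (d : ℕ) :
    ∀ r : ℕ, r + d = F.card + 1 →
      (prodBernoulli p).real (X ∩ {ω : Set ι | r ≤ (F.filter (· ∈ ω)).card}) =
        ∑ i ∈ range d, (prodBernoulli p).real (X ∩ {ω : Set ι | (F.filter (· ∈ ω)).card = r + i}) := by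
  induction d with
  | zero =>
    intro r hr
    rw [threshold_eq_empty_of_card_lt F (by omega), Set.inter_empty, measureReal_empty, Finset.sum_range_zero]
  | succ d ih =>
    intro r hr
    rw [real_inter_upper_succ, ih (r + 1) (by omega), Finset.sum_range_succ', add_comm, add_zero]
    refine congrArg₂ (· + ·) (Finset.sum_congr rfl fun i _ => by rw [show r + 1 + i = r + (i + 1) by ring]) rfl

/-- The measure of `{r ≤ N_F}` as a layer sum. [folklore] -/
theorem real_upper_eq_sum (p : ι → unitInterval) (F : Finset ι) (d r : ℕ) (hr : r + d = F.card + 1) :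
    (prodBernoulli p).real {ω : Set ι | r ≤ (F.filter (· ∈ ω)).card} =
      ∑ i ∈ range d, (prodBernoulli p).real {ω : Set ι | (F.filter (· ∈ ω)).card = r + i} := by
  have h := real_inter_upper_eq_sum p F Set.univ d r hr
  simp only [Set.univ_inter] at h
  exact h

/-! ## The real-sequence core (tool (T4) with the weight shift reversed) -/

omit [Fintype ι] in
/-- **Core inequality of upper MONO-A** on sequences: layer weights `π_i > 0` (`i < d`), `π_d = 0`, log-concave; `y` layer-monotone w.r.t. `π`;
shadow inequality `x_{i+1} π_i ≤ y_i π_{i+1}`.  Then `(Σ_{i<d} π_i)(Σ_{i<d-1} x_{i+1}) ≤ (Σ_{i<d-1} π_{i+1})(Σ_{i<d} y_i)`. [this work] -/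
theorem upper_mlr_core (d : ℕ) (hd : 1 ≤ d) (x y π : ℕ → ℝ) (hπpos : ∀ i, i < d → 0 < π i) (hπnn : ∀ i, 0 ≤ π i) (hπtop : π d = 0)
    (hynn : ∀ i, 0 ≤ y i)
    (hS : ∀ i, x (i + 1) * π i ≤ y i * π (i + 1))
    (hMy : ∀ j k, j < d → k ≤ j → y k * π j ≤ y j * π k)
    (hlc : ∀ j k, j < d → k < j → π k * π (j + 1) ≤ π j * π (k + 1)) :
    (∑ i ∈ range d, π i) * (∑ i ∈ range (d - 1), x (i + 1)) ≤ (∑ i ∈ range (d - 1), π (i + 1)) * (∑ i ∈ range d, y i) := by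
  set v : ℕ → ℝ := fun i => π (i + 1) with hv
  set g : ℕ → ℝ := fun i => y i / π i with hg
  have key := sum_mul_sum_le_of_mlr d π v g
    (fun j k hj hkj => by rw [hv]; dsimp only; exact hlc j k hj hkj)
    (fun j k hj hkj => by
      rw [hg]; dsimp only
      rw [div_le_div_iff₀ (hπpos k (by omega)) (hπpos j (by omega))]
      exact hMy j k hj hkj)
  have e1 : ∑ j ∈ range d, π j * g j = ∑ j ∈ range d, y j := by
    refine Finset.sum_congr rfl fun j hj => ?_
    rw [Finset.mem_range] at hj
    rw [hg]; dsimp only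
    rw [mul_div_cancel₀ _ (hπpos j hj).ne']
  obtain ⟨d', hd'⟩ : ∃ d', d = d' + 1 := ⟨d - 1, by omega⟩
  have e2 : ∑ k ∈ range d, v k = ∑ k ∈ range (d - 1), π (k + 1) := by
    rw [hd', Nat.add_sub_cancel, Finset.sum_range_succ]
    rw [hv]; dsimp only
    rw [← hd', hπtop, add_zero]
  have e3 : ∑ k ∈ range (d - 1), x (k + 1) ≤ ∑ j ∈ range d, v j * g j := by
    rw [hd', Nat.add_sub_cancel, Finset.sum_range_succ]
    have hlast : 0 ≤ v d' * g d' := by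
      rw [hv, hg]; dsimp only
      exact mul_nonneg (hπnn _) (div_nonneg (hynn _) (hπnn _))
    have hmain : ∑ k ∈ range d', x (k + 1) ≤ ∑ k ∈ range d', v k * g k := by
      refine Finset.sum_le_sum fun k hk => ?_
      rw [Finset.mem_range] at hk
      rw [hv, hg]; dsimp only
      rw [mul_div_assoc', le_div_iff₀ (hπpos k (by omega))]
      exact (hS k).trans (le_of_eq (mul_comm _ _))
    linarith
  rw [e1, e2] at key
  have hU : 0 ≤ ∑ k ∈ range d, π k := Finset.sum_nonneg fun k _ => hπnn k
  have h4 : (∑ k ∈ range (d - 1), x (k + 1)) * (∑ k ∈ range d, π k) ≤ (∑ j ∈ range d, v j * g j) * (∑ k ∈ range d, π k) :=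
    mul_le_mul_of_nonneg_right e3 hU
  nlinarith [key, h4]

/-! ## The upper drift of a dominant event -/

/-- **UPPER MONO-A** (memo S3): for `e ∉ F`, densities in `(0,1)` on `F`, an increasing `insert e F`-determined `e`-dominant event `A` and every `r`:
`μ{r ≤ N_F}·μ(A⁰ ∩ {r+1 ≤ N_F}) ≤ μ{r+1 ≤ N_F}·μ(A¹ ∩ {r ≤ N_F})` — the upper-ball-conditioned drift is nonnegative. [this work] -/
theorem upperDrift_nonneg_of_dominant (p : ι → unitInterval) {F : Finset ι} {e : ι} (heF : e ∉ F)
    (hp : ∀ i ∈ F, 0 < (p i : ℝ) ∧ (p i : ℝ) < 1) {A : Set (Set ι)}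
    (hA : IsUpperSet A) (hAF : DeterminedBy A (↑(insert e F) : Set ι))
    (hdom : ∀ ω ∈ A, e ∉ ω → ∀ j ∈ F, j ∈ ω → (ω \ {j}) ∪ {e} ∈ A) (r : ℕ) :
    (prodBernoulli p).real {ω : Set ι | r ≤ (F.filter (· ∈ ω)).card} *
        (prodBernoulli p).real ({ω : Set ι | ω \ {e} ∈ A} ∩ {ω : Set ι | r + 1 ≤ (F.filter (· ∈ ω)).card}) ≤
      (prodBernoulli p).real {ω : Set ι | r + 1 ≤ (F.filter (· ∈ ω)).card} *
        (prodBernoulli p).real ({ω : Set ι | insert e ω ∈ A} ∩ {ω : Set ι | r ≤ (F.filter (· ∈ ω)).card}) := by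
  -- the two sections as `F`-determined increasing events
  have hcoe : (↑(insert e F) : Set ι) \ {e} = ↑F := by
    ext i
    simp only [Set.mem_sdiff, Finset.coe_insert, Set.mem_insert_iff, Finset.mem_coe, Set.mem_singleton_iff]
    constructor
    · rintro ⟨h | h, hne⟩
      · exact absurd h hne
      · exact h
    · intro h
      exact ⟨Or.inr h, fun hie => heF (hie ▸ h)⟩
  have hA1F : DeterminedBy {ω : Set ι | insert e ω ∈ A} (↑F : Set ι) := hcoe ▸ determinedBy_section_insert hAF e
  have hA0F : DeterminedBy {ω : Set ι | ω \ {e} ∈ A} (↑F : Set ι) := hcoe ▸ determinedBy_section_sdiff hAF e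
  have hA1 : IsUpperSet {ω : Set ι | insert e ω ∈ A} := isUpperSet_section_insert hA e
  have hdel := section_erase_mem_of_dominant heF hdom
  -- trivial case `r > #F`: both upper regions are empty
  by_cases hr : F.card < r
  · have h1 := threshold_eq_empty_of_card_lt F hr
    have h2 := threshold_eq_empty_of_card_lt F (show F.card < r + 1 by omega)
    simp only [h1, h2, Set.inter_empty, measureReal_empty, mul_zero, le_refl]
  push Not at hr
  set d : ℕ := F.card + 1 - r with hd
  have hrd : r + d = F.card + 1 := by omega
  -- the four measures as layer sums, the `(r+1)`-sums reindexed to `r + (i+1)`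
  rw [real_upper_eq_sum p F d r hrd, real_inter_upper_eq_sum p F _ d r hrd,
    real_upper_eq_sum p F (d - 1) (r + 1) (by omega), real_inter_upper_eq_sum p F _ (d - 1) (r + 1) (by omega)]
  have e4 : ∑ i ∈ range (d - 1), (prodBernoulli p).real {ω : Set ι | (F.filter (· ∈ ω)).card = r + 1 + i} =
      ∑ i ∈ range (d - 1), (prodBernoulli p).real {ω : Set ι | (F.filter (· ∈ ω)).card = r + (i + 1)} :=
    Finset.sum_congr rfl fun i _ => by rw [show r + 1 + i = r + (i + 1) by ring]
  have e5 : ∑ i ∈ range (d - 1), (prodBernoulli p).real ({ω : Set ι | ω \ {e} ∈ A} ∩ {ω : Set ι | (F.filter (· ∈ ω)).card = r + 1 + i}) =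
      ∑ i ∈ range (d - 1), (prodBernoulli p).real ({ω : Set ι | ω \ {e} ∈ A} ∩ {ω : Set ι | (F.filter (· ∈ ω)).card = r + (i + 1)}) :=
    Finset.sum_congr rfl fun i _ => by rw [show r + 1 + i = r + (i + 1) by ring]
  rw [e4, e5]
  -- apply the core with `x_i = μ(A⁰ ∩ {N_F = r+i})`, `y_i = μ(A¹ ∩ {N_F = r+i})`, `π_i = μ{N_F = r+i}`
  refine upper_mlr_core d (by omega)
    (fun i => (prodBernoulli p).real ({ω : Set ι | ω \ {e} ∈ A} ∩ {ω : Set ι | (F.filter (· ∈ ω)).card = r + i}))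
    (fun i => (prodBernoulli p).real ({ω : Set ι | insert e ω ∈ A} ∩ {ω : Set ι | (F.filter (· ∈ ω)).card = r + i}))
    (fun i => (prodBernoulli p).real {ω : Set ι | (F.filter (· ∈ ω)).card = r + i})
    (fun i hi => real_layer_pos p F hp (by omega)) (fun i => measureReal_nonneg) ?_ (fun i => measureReal_nonneg) ?_ ?_ ?_
  · -- the layer above `#F` is empty
    rw [layer_eq_empty_of_card_lt F (by omega), measureReal_empty]
  · -- shadow inequality
    intro i
    rw [show r + (i + 1) = r + i + 1 by ring]
    exact real_shadow_layer_mul_le p F hA0F hA1F hdel (r + i)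
  · -- layer monotonicity of `A¹`
    intro j k hj hkj
    exact real_inter_layer_mul_le p F hA1 hA1F (by omega)
  · -- log-concavity of the layer law
    intro j k hj hkj
    have h := real_layer_logConcave p F (a := r + k) (b := r + j) (by omega)
    rw [show r + (k + 1) = r + k + 1 by ring, show r + (j + 1) = r + j + 1 by ring]
    linarith [h]

end SahiOneStep

end Summit.CriticalPhenomena.PercolationContinuityZ3.Theorems
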